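import Literature.Analysis.FluidPDE.LerayHopfTimeSliceTorus
import Literature.Analysis.FluidPDE.StatisticalSolutionEnergyEq
import Literature.Analysis.FunctionSpaces.TorusScalarTrigPoly
import Literature.Analysis.FunctionSpaces.TorusEnstrophyOrthogonality
import HarnessLib

/-!
# The Navier–Stokes generator against cylindrical test functionals

Analysis/FluidPDE support file for the discharge of
`Literature.Analysis.FluidPDE.timeAverage_isStationary` (Foias–Manley–Rosa–Temam 2001, Ch. IV
Thm. 3.1). For a cylindrical test functional `Φ(u) = φ((u,g₁),…,(u,gₘ))`
(`Torus.CylindricalTest`, accepted `StatisticalSolution`; FMRT 2001, Ch. IV §1.2, the example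
after Def. 1.2, PDF p. 197) the differential is the finite combination
`Φ'(u) = ∑ᵢ ∂ᵢφ(coords u) gᵢ` of the smooth solenoidal fields `gᵢ`, and the tested generator
`⟨F(u), Φ'(u)⟩ = (f, Φ'(u)) + ν (u, ΔΦ'(u)) + ∫ (u ⊗ u) : ∇Φ'(u)` (`Torus.nsGeneratorPairing`,
all derivatives on the test field) is what the Liouville equation (1.30) integrates. This file
records the bookkeeping the printed proof (App. B.2, PDF pp. 255–259) performs on it:

* `laplacian_sum_smul`, `fderiv_sum_smul`, `isSmooth_sum_smul` — calculus of finite combinations;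
* `nsGeneratorPairing_sum_smul`, `nsGeneratorPairing_grad` — **linearity in the test field**:
  `⟨F(u), Φ'(u)⟩ = ∑ᵢ ∂ᵢφ(coords u) ⟨F(u), gᵢ⟩`;
* `continuous_inertialPairing_coe`, `continuous_nsGeneratorPairing`,
  `continuous_nsGeneratorPairing_grad` — `u ↦ ⟨F(u), g⟩` and `u ↦ ⟨F(u), Φ'(u)⟩` are
  norm-continuous on `H` (for smooth `g`: a constant, a bounded linear and a bounded quadratic
  form on `L²`);
* `exists_abs_nsGeneratorPairing_le`, `exists_abs_nsGeneratorPairing_grad_le` — the bound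
  `|⟨F(u), Φ'(u)⟩| ≤ C (1 + |u|²)` on `H` (FMRT p. 197, display before Def. 1.3, here with all
  derivatives on the smooth `gᵢ`, so only `|u|²` — not `‖u‖²` — enters);
* `nsGeneratorPairing_eq_flux` — along an `L²` slice lifted to `H` the tested generator is
  the flux `∫ (⟪u, (u·∇)g⟫ + ν ⟪u, Δg⟫ + ⟪f, g⟫)` of the time-sliced weak formulation
  (`Torus.IsLerayHopfOn.integral_inner_eq_add_setIntegral`, `LerayHopfTimeSliceTorus`).

## Mathlib / tree search

Used from the tree: `Torus.laplacian_const_smul`, `Torus.integrable_inner_convect_self`,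
`Torus.exists_sum_norm_partialDeriv_le`, `Torus.aestronglyMeasurable_inner_convect`
(`LerayHopfTimeSliceTorus`, `NSHopfGalerkinLimit`), `Torus.fderiv_fun_sum` (`TorusScalarTrigPoly`),
`Torus.fderiv_const_smul` (`TorusTestFunction`), `Torus.partialDeriv_finset_sum`
(`TorusEnstrophyOrthogonality`), `Torus.laplacian_eq_sum_partialDeriv_partialDeriv`
(`TorusCalculusProofs`), `Torus.norm_fderiv_apply_le`, `Torus.integrable_inner_of_continuous`
(`TorusFourierModes`), `Torus.continuous_pairing_coe`, `Torus.abs_pairing_coe_le`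
(`StatisticalSolutionEnergyEq`), `Torus.integral_norm_sq_coe_eq` (`StatisticalSolutionProofs`);
from Mathlib `integral_mul_norm_le_Lp_mul_Lq` (Cauchy–Schwarz). No continuity statement for
`inertialPairing` / `nsGeneratorPairing` in `u` existed (searched `continuous_inertialPairing`,
`nsGeneratorPairing`: only the Fourier-truncated identities of `StatisticalSolutionEnergyEq`).

## References

* C. Foias, O. Manley, R. Rosa, R. Temam, *Navier–Stokes Equations and Turbulence*, Cambridge
  Univ. Press (2001), Ch. IV §1.2 Def. 1.2 and the display before Def. 1.3 (PDF p. 197);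
  App. B.2 (B.17)–(B.20) (PDF pp. 255–257). [FMRT2001]
-/

noncomputable section

open MeasureTheory Set Filter Topology UnitAddTorus
open scoped InnerProductSpace RealInnerProductSpace ENNReal NNReal

namespace Literature.Analysis.FluidPDE.Torus

variable {d : Type*} [Fintype d] [DecidableEq d]

/-- Local notation for the real Hilbert space `L²(T^d; ℝ^d)`. -/
local notation "L2T " d':max => Lp (EuclideanSpace ℝ d') 2 (volume : Measure (UnitAddTorus d'))

/-- Local notation for real vector fields `T^d → ℝ^d`. -/
local notation "Vec " d':max => UnitAddTorus d' → EuclideanSpace ℝ d'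

/-! ### Calculus of finite combinations of smooth fields -/

section SumSmul

variable {ι : Type*} (s : Finset ι) (c : ι → ℝ) {g : ι → Vec d}

omit [DecidableEq d] in
/-- A finite combination `∑ᵢ cᵢ gᵢ` of smooth fields is smooth. [folklore] -/
theorem isSmooth_sum_smul (hg : ∀ i ∈ s, FunctionSpaces.Torus.IsSmooth (g i)) :
    FunctionSpaces.Torus.IsSmooth (fun x => ∑ i ∈ s, c i • g i x) := by
  have hl : FunctionSpaces.Torus.lift (fun x => ∑ i ∈ s, c i • g i x) =
      fun z => ∑ i ∈ s, c i • FunctionSpaces.Torus.lift (g i) z := rfl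
  unfold FunctionSpaces.Torus.IsSmooth
  rw [hl]
  exact ContDiff.sum fun i hi => (hg i hi).const_smul (c i)

/-- The Laplacian of a finite combination of smooth fields: `Δ(∑ᵢ cᵢ gᵢ) = ∑ᵢ cᵢ Δgᵢ`. [folklore] -/
theorem laplacian_sum_smul (hg : ∀ i ∈ s, FunctionSpaces.Torus.IsSmooth (g i)) (x : UnitAddTorus d) :
    FunctionSpaces.Torus.laplacian (fun y => ∑ i ∈ s, c i • g i y) x =
      ∑ i ∈ s, c i • FunctionSpaces.Torus.laplacian (g i) x := by
  have hsm : ∀ i ∈ s, FunctionSpaces.Torus.IsSmooth (fun y => c i • g i y) := fun i hi =>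
    (hg i hi).smul (c i)
  have hsum : FunctionSpaces.Torus.IsSmooth (fun y => ∑ i ∈ s, c i • g i y) := isSmooth_sum_smul s c hg
  rw [FunctionSpaces.Torus.laplacian_eq_sum_partialDeriv_partialDeriv hsum]
  have h1 : ∀ j, FunctionSpaces.Torus.partialDeriv j (fun y => ∑ i ∈ s, c i • g i y) =
      fun y => ∑ i ∈ s, FunctionSpaces.Torus.partialDeriv j (fun y => c i • g i y) y :=
    fun j => funext fun y => FunctionSpaces.Torus.partialDeriv_finset_sum s
      (fun i hi => (hsm i hi).isContDiff (by simp)) j y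
  simp_rw [h1]
  rw [Finset.sum_congr rfl fun j _ => FunctionSpaces.Torus.partialDeriv_finset_sum s
    (fun i hi => ((hsm i hi).partialDeriv j).isContDiff (by simp)) j x, Finset.sum_comm]
  refine Finset.sum_congr rfl fun i hi => ?_
  rw [← laplacian_const_smul (hg i hi) (c i) x,
    FunctionSpaces.Torus.laplacian_eq_sum_partialDeriv_partialDeriv (hsm i hi)]

omit [DecidableEq d] in
/-- The derivative of a finite combination of `C¹` fields:
`D(∑ᵢ cᵢ gᵢ)(x) = ∑ᵢ cᵢ Dgᵢ(x)`. [folklore] -/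
theorem fderiv_sum_smul (hg : ∀ i ∈ s, FunctionSpaces.Torus.IsSmooth (g i)) (x : UnitAddTorus d) :
    FunctionSpaces.Torus.fderiv (fun y => ∑ i ∈ s, c i • g i y) x =
      ∑ i ∈ s, c i • FunctionSpaces.Torus.fderiv (g i) x := by
  have h1 : ∀ i ∈ s, FunctionSpaces.Torus.IsContDiff 1 (fun y => c i • g i y) := fun i hi =>
    ((hg i hi).smul (c i)).isContDiff (by simp)
  rw [FunctionSpaces.Torus.fderiv_fun_sum s h1 x]
  refine Finset.sum_congr rfl fun i hi => ?_
  rw [show (fun y => c i • g i y) = c i • g i from rfl,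
    FunctionSpaces.Torus.fderiv_const_smul ((hg i hi).isContDiff (by simp)) (c i) x]

end SumSmul

/-! ### Linearity of the tested generator in the test field -/

section Linearity

variable (ν : ℝ) {f : Vec d}

/-- **Linearity of the tested generator in the test field**: for smooth `gᵢ`, an integrable force
and `u ∈ H`, `⟨F(u), ∑ᵢ cᵢ gᵢ⟩ = ∑ᵢ cᵢ ⟨F(u), gᵢ⟩` (each summand of `nsGeneratorPairing` is a
genuine integral here). [cite: FMRT2001, Ch. IV §1.2 Def. 1.2 (example), p. 197] -/
theorem nsGeneratorPairing_sum_smul (hf : Integrable f volume) (u : FunctionSpaces.Torus.energySpace d)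
    {ι : Type*} (s : Finset ι) (c : ι → ℝ) {g : ι → Vec d}
    (hg : ∀ i ∈ s, FunctionSpaces.Torus.IsSmooth (g i)) :
    nsGeneratorPairing ν f u (fun x => ∑ i ∈ s, c i • g i x) =
      ∑ i ∈ s, c i * nsGeneratorPairing ν f u (g i) := by
  have hu2 : MemLp ((u : L2T d) : Vec d) 2 volume := Lp.memLp _
  have hu1 : Integrable ((u : L2T d) : Vec d) volume := hu2.integrable one_le_two
  -- the three summands, one field at a time
  have hT1 : ∀ i ∈ s, Integrable (fun x => ⟪f x, g i x⟫) volume := fun i hi =>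
    FunctionSpaces.Torus.integrable_inner_of_continuous hf (hg i hi).continuous
  have hT2 : ∀ i ∈ s, Integrable (fun x => ⟪((u : L2T d) : Vec d) x, FunctionSpaces.Torus.laplacian (g i) x⟫) volume :=
    fun i hi => FunctionSpaces.Torus.integrable_inner_of_continuous hu1 (hg i hi).laplacian.continuous
  have hT3 : ∀ i ∈ s, Integrable (fun x => ⟪FunctionSpaces.Torus.fderiv (g i) x (((u : L2T d) : Vec d) x),
      ((u : L2T d) : Vec d) x⟫) volume := fun i hi => by
    have h := integrable_inner_convect_self hu2 (hg i hi)
    refine h.congr (ae_of_all _ fun x => ?_)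
    exact real_inner_comm _ _
  -- first term
  have e1 : ∫ x, ⟪f x, ∑ i ∈ s, c i • g i x⟫ = ∑ i ∈ s, c i * ∫ x, ⟪f x, g i x⟫ := by
    simp_rw [inner_sum, real_inner_smul_right]
    rw [integral_finsetSum s fun i hi => (hT1 i hi).const_mul (c i)]
    exact Finset.sum_congr rfl fun i _ => integral_const_mul _ _
  -- second term
  have e2 : ∫ x, ⟪((u : L2T d) : Vec d) x, FunctionSpaces.Torus.laplacian (fun y => ∑ i ∈ s, c i • g i y) x⟫ =
      ∑ i ∈ s, c i * ∫ x, ⟪((u : L2T d) : Vec d) x, FunctionSpaces.Torus.laplacian (g i) x⟫ := by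
    simp_rw [laplacian_sum_smul s c hg, inner_sum, real_inner_smul_right]
    rw [integral_finsetSum s fun i hi => (hT2 i hi).const_mul (c i)]
    exact Finset.sum_congr rfl fun i _ => integral_const_mul _ _
  -- third term
  have e3 : inertialPairing (u : L2T d) (fun y => ∑ i ∈ s, c i • g i y) =
      ∑ i ∈ s, c i * inertialPairing (u : L2T d) (g i) := by
    unfold inertialPairing
    simp_rw [fderiv_sum_smul s c hg, _root_.sum_apply, _root_.smul_apply,
      sum_inner, real_inner_smul_left]
    rw [integral_finsetSum s fun i hi => (hT3 i hi).const_mul (c i)]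
    exact Finset.sum_congr rfl fun i _ => integral_const_mul _ _
  unfold nsGeneratorPairing
  rw [e1, e2, e3, Finset.mul_sum, ← Finset.sum_add_distrib, ← Finset.sum_add_distrib]
  refine Finset.sum_congr rfl fun i _ => ?_
  unfold inertialPairing
  ring

/-- **The tested generator of a cylindrical functional**:
`⟨F(u), Φ'(u)⟩ = ∑ᵢ ∂ᵢφ(coords u) ⟨F(u), gᵢ⟩` (`Φ'(u) = ∑ᵢ ∂ᵢφ(coords u) gᵢ`,
FMRT 2001, Ch. IV p. 197). [cite: FMRT2001, Ch. IV §1.2, p. 197] -/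
theorem nsGeneratorPairing_grad (hf : Integrable f volume) (Φ : CylindricalTest d)
    (u : FunctionSpaces.Torus.energySpace d) :
    nsGeneratorPairing ν f u (Φ.grad u) =
      ∑ i, _root_.fderiv ℝ Φ.φ (Φ.coords u) (EuclideanSpace.single i 1) *
        nsGeneratorPairing ν f u (Φ.g i) :=
  nsGeneratorPairing_sum_smul ν hf u Finset.univ _ fun i _ => Φ.g_smooth i

end Linearity

/-! ### Continuity on `H` -/

section Continuity

omit [DecidableEq d] in
/-- **Cauchy–Schwarz for `L²` classes** on the torus: `∫ ‖a‖ ‖b‖ ≤ ‖a‖ ‖b‖`. [folklore] -/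
theorem integral_norm_mul_norm_coe_le (a b : L2T d) :
    ∫ x, ‖(a : Vec d) x‖ * ‖(b : Vec d) x‖ ≤ ‖a‖ * ‖b‖ := by
  have ha : MemLp (a : Vec d) 2 volume := Lp.memLp a
  have hb : MemLp (b : Vec d) 2 volume := Lp.memLp b
  have h := integral_mul_norm_le_Lp_mul_Lq (μ := volume) (f := fun x => ‖(a : Vec d) x‖)
    (g := fun x => ‖(b : Vec d) x‖) Real.HolderConjugate.two_two (by simpa using ha.norm)
    (by simpa using hb.norm)
  simp only [norm_norm, Real.rpow_two, one_div] at h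
  rw [integral_norm_sq_coe_eq, integral_norm_sq_coe_eq] at h
  have e : ∀ r : ℝ, 0 ≤ r → (r ^ 2) ^ (2⁻¹ : ℝ) = r := fun r hr => by
    rw [show (2⁻¹ : ℝ) = 1 / 2 by norm_num, ← Real.sqrt_eq_rpow, Real.sqrt_sq hr]
  rw [e _ (norm_nonneg a), e _ (norm_nonneg b)] at h
  exact h

/-- Measurability of the mixed convective pairing `x ↦ ⟪Dg(x) a(x), b(x)⟫` for a.e. strongly
measurable `a, b` and smooth `g` (`Dg(x) a = ∑ᵢ aᵢ ∂ᵢg`). [folklore] -/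
theorem aestronglyMeasurable_inner_fderiv_apply {a b g : Vec d} (ha : AEStronglyMeasurable a volume)
    (hb : AEStronglyMeasurable b volume) (hg : FunctionSpaces.Torus.IsSmooth g) :
    AEStronglyMeasurable (fun x => ⟪FunctionSpaces.Torus.fderiv g x (a x), b x⟫) volume := by
  have h : (fun x => FunctionSpaces.Torus.fderiv g x (a x)) =
      fun x => ∑ i, (a x) i • FunctionSpaces.Torus.partialDeriv i g x := by
    funext x
    exact FunctionSpaces.Torus.fderiv_apply_eq_sum_partialDeriv (hg.isContDiff (by simp)) _ _
  have hconv : AEStronglyMeasurable (fun x => FunctionSpaces.Torus.fderiv g x (a x)) volume := by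
    rw [h]
    exact Finset.aestronglyMeasurable_fun_sum _ fun i _ =>
      ((EuclideanSpace.proj (𝕜 := ℝ) i).continuous.comp_aestronglyMeasurable ha).smul
        (hg.partialDeriv i).continuous.aestronglyMeasurable
  exact hconv.inner hb

/-- **The convective bilinear form is bounded on `L²`**: for smooth `g` with
`∑ᵢ ‖∂ᵢg‖ ≤ C`, the integrand `⟪Dg(x) a(x), b(x)⟫` is integrable for `a, b ∈ L²` and
`|∫ ⟪Dg a, b⟫| ≤ C ‖a‖ ‖b‖`. [folklore] -/
theorem integrable_inner_fderiv_apply_coe {g : Vec d} (hg : FunctionSpaces.Torus.IsSmooth g) {C : ℝ}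
    (hC : ∀ x, ∑ i, ‖FunctionSpaces.Torus.partialDeriv i g x‖ ≤ C) (a b : L2T d) :
    Integrable (fun x => ⟪FunctionSpaces.Torus.fderiv g x ((a : Vec d) x), (b : Vec d) x⟫) volume ∧
      |∫ x, ⟪FunctionSpaces.Torus.fderiv g x ((a : Vec d) x), (b : Vec d) x⟫| ≤ C * (‖a‖ * ‖b‖) := by
  have ha : MemLp (a : Vec d) 2 volume := Lp.memLp a
  have hb : MemLp (b : Vec d) 2 volume := Lp.memLp b
  have hprod : Integrable (fun x => ‖(a : Vec d) x‖ * ‖(b : Vec d) x‖) volume := by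
    have h : MemLp ((fun x => ‖(b : Vec d) x‖) * fun x => ‖(a : Vec d) x‖) 1 volume := ha.norm.mul hb.norm
    refine (memLp_one_iff_integrable.1 h).congr (ae_of_all _ fun x => ?_)
    simp only [Pi.mul_apply]
    ring
  have hpt : ∀ x, ‖⟪FunctionSpaces.Torus.fderiv g x ((a : Vec d) x), (b : Vec d) x⟫‖ ≤
      C * (‖(a : Vec d) x‖ * ‖(b : Vec d) x‖) := fun x => by
    refine (norm_inner_le_norm _ _).trans ?_
    have h1 := FunctionSpaces.Torus.norm_fderiv_apply_le (hg.isContDiff (by simp)) x ((a : Vec d) x)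
    calc ‖FunctionSpaces.Torus.fderiv g x ((a : Vec d) x)‖ * ‖(b : Vec d) x‖
        ≤ (‖(a : Vec d) x‖ * C) * ‖(b : Vec d) x‖ := by
          refine mul_le_mul_of_nonneg_right (h1.trans ?_) (norm_nonneg _)
          exact mul_le_mul_of_nonneg_left (hC x) (norm_nonneg _)
      _ = C * (‖(a : Vec d) x‖ * ‖(b : Vec d) x‖) := by ring
  have hint : Integrable (fun x => ⟪FunctionSpaces.Torus.fderiv g x ((a : Vec d) x), (b : Vec d) x⟫) volume :=
    Integrable.mono' (hprod.const_mul C)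
      (aestronglyMeasurable_inner_fderiv_apply (Lp.memLp a).1 (Lp.memLp b).1 hg)
      (ae_of_all _ hpt)
  refine ⟨hint, ?_⟩
  rw [← Real.norm_eq_abs]
  calc ‖∫ x, ⟪FunctionSpaces.Torus.fderiv g x ((a : Vec d) x), (b : Vec d) x⟫‖
      ≤ ∫ x, C * (‖(a : Vec d) x‖ * ‖(b : Vec d) x‖) :=
        norm_integral_le_of_norm_le (hprod.const_mul C) (ae_of_all _ hpt)
    _ = C * ∫ x, ‖(a : Vec d) x‖ * ‖(b : Vec d) x‖ := integral_const_mul _ _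
    _ ≤ C * (‖a‖ * ‖b‖) := by
        have hC0 : 0 ≤ C := le_trans (Finset.sum_nonneg fun i _ => norm_nonneg _) (hC 0)
        exact mul_le_mul_of_nonneg_left (integral_norm_mul_norm_coe_le a b) hC0

/-- **The inertial pairing is norm-continuous on `L²`**: `u ↦ ∫ (u ⊗ u) : ∇g` is a bounded
quadratic form for smooth `g` (`|Q(u) - Q(v)| ≤ C ‖u - v‖ (‖u‖ + ‖v‖)`). [folklore] -/
theorem continuous_inertialPairing {g : Vec d} (hg : FunctionSpaces.Torus.IsSmooth g) :
    Continuous fun u : L2T d => inertialPairing u g := by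
  obtain ⟨C, hC0, hC⟩ := exists_sum_norm_partialDeriv_le hg
  -- the bilinear form and its bound
  set B : L2T d → L2T d → ℝ := fun a b =>
    ∫ x, ⟪FunctionSpaces.Torus.fderiv g x ((a : Vec d) x), (b : Vec d) x⟫ with hB
  have hBi := fun a b => (integrable_inner_fderiv_apply_coe hg hC a b).1
  have hBb : ∀ a b, |B a b| ≤ C * (‖a‖ * ‖b‖) := fun a b =>
    (integrable_inner_fderiv_apply_coe hg hC a b).2
  have hBsub₁ : ∀ a₁ a₂ b, B (a₁ - a₂) b = B a₁ b - B a₂ b := by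
    intro a₁ a₂ b
    simp only [hB]
    rw [← integral_sub (hBi a₁ b) (hBi a₂ b)]
    refine integral_congr_ae ?_
    filter_upwards [Lp.coeFn_sub a₁ a₂] with x hx
    rw [hx, Pi.sub_apply, map_sub, inner_sub_left]
  have hBsub₂ : ∀ a b₁ b₂, B a (b₁ - b₂) = B a b₁ - B a b₂ := by
    intro a b₁ b₂
    simp only [hB]
    rw [← integral_sub (hBi a b₁) (hBi a b₂)]
    refine integral_congr_ae ?_
    filter_upwards [Lp.coeFn_sub b₁ b₂] with x hx
    rw [hx, Pi.sub_apply, inner_sub_right]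
  have hQ : ∀ u : L2T d, inertialPairing u g = B u u := fun u => rfl
  -- continuity at every point
  refine continuous_iff_continuousAt.2 fun v₀ => ?_
  have hdiff : ∀ v, inertialPairing v g - inertialPairing v₀ g = B (v - v₀) v + B v₀ (v - v₀) := by
    intro v
    rw [hQ, hQ, hBsub₁, hBsub₂]
    ring
  rw [ContinuousAt, tendsto_iff_norm_sub_tendsto_zero]
  have hbound : ∀ v, ‖inertialPairing v g - inertialPairing v₀ g‖ ≤
      C * (‖v - v₀‖ * ‖v‖) + C * (‖v₀‖ * ‖v - v₀‖) := fun v => by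
    rw [hdiff, Real.norm_eq_abs]
    exact (abs_add_le _ _).trans (add_le_add (hBb _ _) (hBb _ _))
  have hlim : Tendsto (fun v : L2T d => C * (‖v - v₀‖ * ‖v‖) + C * (‖v₀‖ * ‖v - v₀‖)) (𝓝 v₀) (𝓝 0) := by
    have hc : Continuous fun v : L2T d => C * (‖v - v₀‖ * ‖v‖) + C * (‖v₀‖ * ‖v - v₀‖) := by
      fun_prop
    simpa using hc.tendsto v₀
  exact squeeze_zero_norm' (Eventually.of_forall fun v => by
    rw [norm_norm]; exact hbound v) hlim

/-- The inertial pairing is norm-continuous on `H`. [folklore] -/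
theorem continuous_inertialPairing_coe {g : Vec d} (hg : FunctionSpaces.Torus.IsSmooth g) :
    Continuous fun u : FunctionSpaces.Torus.energySpace d => inertialPairing (u : L2T d) g :=
  (continuous_inertialPairing hg).comp continuous_subtype_val

/-- **The tested generator `u ↦ ⟨F(u), g⟩` is norm-continuous on `H`** for a smooth field `g`
(constant + bounded linear + bounded quadratic form; FMRT 2001, App. B.2: on `H` the map
`u ↦ (F_k(u), Φ'_m(u))` is continuous — here no Galerkin truncation is needed because all
derivatives fall on `g`). [cite: FMRT2001, App. B.2, p. 257] -/
theorem continuous_nsGeneratorPairing (ν : ℝ) (f : Vec d) {g : Vec d} (hg : FunctionSpaces.Torus.IsSmooth g) :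
    Continuous fun u : FunctionSpaces.Torus.energySpace d => nsGeneratorPairing ν f u g := by
  unfold nsGeneratorPairing
  refine (continuous_const.add (continuous_const.mul ?_)).add (continuous_inertialPairing_coe hg)
  exact continuous_pairing_coe (hg.laplacian.memLp 2)

/-- The coordinates `u ↦ ((u,g₁),…,(u,gₘ))` of a cylindrical test functional are continuous on
`H`. [folklore] -/
theorem CylindricalTest.continuous_coords (Φ : CylindricalTest d) : Continuous Φ.coords := by
  unfold CylindricalTest.coords
  exact (PiLp.continuous_toLp 2 _).comp
    (continuous_pi fun i => continuous_pairing_coe ((Φ.g_smooth i).memLp 2))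

/-- The coefficients `u ↦ ∂ᵢφ(coords u)` of `Φ'(u)` are continuous on `H` (`φ ∈ C¹`). [folklore] -/
theorem CylindricalTest.continuous_fderiv_coords (Φ : CylindricalTest d) (i : Fin Φ.m) :
    Continuous fun u : FunctionSpaces.Torus.energySpace d =>
      _root_.fderiv ℝ Φ.φ (Φ.coords u) (EuclideanSpace.single i 1) :=
  (ContinuousLinearMap.apply ℝ ℝ (EuclideanSpace.single i (1 : ℝ))).continuous.comp
    ((Φ.φ_contDiff.continuous_fderiv one_ne_zero).comp Φ.continuous_coords)

/-- The coefficients `∂ᵢφ(coords u)` of `Φ'(u)` are bounded on `H` (`φ ∈ C¹_c`). [folklore] -/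
theorem CylindricalTest.exists_abs_fderiv_coords_le (Φ : CylindricalTest d) :
    ∃ M : ℝ, 0 ≤ M ∧ ∀ (u : FunctionSpaces.Torus.energySpace d) (i : Fin Φ.m),
      |_root_.fderiv ℝ Φ.φ (Φ.coords u) (EuclideanSpace.single i 1)| ≤ M := by
  obtain ⟨M, hM⟩ := (Φ.φ_contDiff.continuous_fderiv one_ne_zero).bounded_above_of_compact_support
    (Φ.φ_compact.fderiv (𝕜 := ℝ))
  refine ⟨max M 0, le_max_right _ _, fun u i => ?_⟩
  rw [← Real.norm_eq_abs]
  have hs : ‖EuclideanSpace.single i (1 : ℝ)‖ = 1 := by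
    simp
  calc ‖_root_.fderiv ℝ Φ.φ (Φ.coords u) (EuclideanSpace.single i 1)‖
      ≤ ‖_root_.fderiv ℝ Φ.φ (Φ.coords u)‖ * ‖EuclideanSpace.single i (1 : ℝ)‖ :=
        ContinuousLinearMap.le_opNorm _ _
    _ ≤ M := by
        rw [hs, mul_one]
        exact hM _
    _ ≤ max M 0 := le_max_left _ _

/-- **The tested generator of a cylindrical functional, `u ↦ ⟨F(u), Φ'(u)⟩`, is norm-continuous
on `H`** (finite sum of products of continuous functions). [cite: FMRT2001, App. B.2, p. 257] -/
theorem continuous_nsGeneratorPairing_grad (ν : ℝ) {f : Vec d} (hf : Integrable f volume)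
    (Φ : CylindricalTest d) :
    Continuous fun u : FunctionSpaces.Torus.energySpace d => nsGeneratorPairing ν f u (Φ.grad u) := by
  have h : (fun u : FunctionSpaces.Torus.energySpace d => nsGeneratorPairing ν f u (Φ.grad u)) =
      fun u => ∑ i, _root_.fderiv ℝ Φ.φ (Φ.coords u) (EuclideanSpace.single i 1) *
        nsGeneratorPairing ν f u (Φ.g i) := funext fun u => nsGeneratorPairing_grad ν hf Φ u
  rw [h]
  exact continuous_finsetSum _ fun i _ =>
    (Φ.continuous_fderiv_coords i).mul (continuous_nsGeneratorPairing ν f (Φ.g_smooth i))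

end Continuity

/-! ### Growth: `|⟨F(u), Φ'(u)⟩| ≤ K (1 + |u|²)` -/

section Bounds

/-- **Growth of the tested generator** for a fixed smooth field: with `f ∈ L²`,
`|⟨F(u), g⟩| ≤ K (1 + |u|²)` on `H` (`|(f,g)|` constant — whatever the Bochner value —, `|ν (u, Δg)| ≤ |ν| |u| ‖Δg‖`,
`|∫ (u⊗u):∇g| ≤ C |u|²`; FMRT 2001, Ch. IV p. 197, display before Def. 1.3, with all derivatives
on `g`). [cite: FMRT2001, Ch. IV §1.2, p. 197] -/
theorem exists_abs_nsGeneratorPairing_le (ν : ℝ) (f : Vec d) {g : Vec d}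
    (hg : FunctionSpaces.Torus.IsSmooth g) :
    ∃ K : ℝ, 0 ≤ K ∧ ∀ u : FunctionSpaces.Torus.energySpace d, |nsGeneratorPairing ν f u g| ≤ K * (1 + ‖u‖ ^ 2) := by
  obtain ⟨C, hC0, hC⟩ := exists_sum_norm_partialDeriv_le hg
  have hΔ : MemLp (FunctionSpaces.Torus.laplacian g) 2 volume := hg.laplacian.memLp 2
  set A : ℝ := |∫ x, ⟪f x, g x⟫| with hA
  set L : ℝ := ‖hΔ.toLp (FunctionSpaces.Torus.laplacian g)‖ with hL
  refine ⟨A + |ν| * L + C, by positivity, fun u => ?_⟩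
  have hu1 : ‖u‖ ≤ 1 + ‖u‖ ^ 2 := by nlinarith [sq_nonneg (‖u‖ - 1), norm_nonneg u]
  -- the linear term
  have h2 : |ν * ∫ x, ⟪((u : L2T d) : Vec d) x, FunctionSpaces.Torus.laplacian g x⟫| ≤ |ν| * L * (1 + ‖u‖ ^ 2) := by
    rw [abs_mul, mul_assoc]
    refine mul_le_mul_of_nonneg_left ?_ (abs_nonneg ν)
    have h := abs_pairing_coe_le hΔ u
    rw [pairing] at h
    calc |∫ x, ⟪((u : L2T d) : Vec d) x, FunctionSpaces.Torus.laplacian g x⟫| ≤ ‖u‖ * L := h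
      _ ≤ (1 + ‖u‖ ^ 2) * L := mul_le_mul_of_nonneg_right hu1 (norm_nonneg _)
      _ = L * (1 + ‖u‖ ^ 2) := mul_comm _ _
  -- the quadratic term
  have h3 : |inertialPairing (u : L2T d) g| ≤ C * (1 + ‖u‖ ^ 2) := by
    have h := (integrable_inner_fderiv_apply_coe hg hC (u : L2T d) (u : L2T d)).2
    rw [inertialPairing]
    refine h.trans (mul_le_mul_of_nonneg_left ?_ hC0)
    rw [← sq, Submodule.coe_norm]
    linarith [sq_nonneg ‖(u : L2T d)‖]
  have h1 : A ≤ A * (1 + ‖u‖ ^ 2) := le_mul_of_one_le_right (abs_nonneg _) (by nlinarith [sq_nonneg ‖u‖])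
  unfold nsGeneratorPairing
  calc |(∫ x, ⟪f x, g x⟫) + ν * (∫ x, ⟪((u : L2T d) : Vec d) x, FunctionSpaces.Torus.laplacian g x⟫) +
          inertialPairing (u : L2T d) g|
      ≤ |∫ x, ⟪f x, g x⟫| + |ν * ∫ x, ⟪((u : L2T d) : Vec d) x, FunctionSpaces.Torus.laplacian g x⟫| +
          |inertialPairing (u : L2T d) g| := abs_add_three _ _ _
    _ ≤ A * (1 + ‖u‖ ^ 2) + |ν| * L * (1 + ‖u‖ ^ 2) + C * (1 + ‖u‖ ^ 2) := add_le_add_three h1 h2 h3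
    _ = (A + |ν| * L + C) * (1 + ‖u‖ ^ 2) := by ring

/-- **Growth of the tested generator of a cylindrical functional**:
`|⟨F(u), Φ'(u)⟩| ≤ K (1 + |u|²)` on `H` for `f ∈ L²` (the coefficients `∂ᵢφ` are bounded,
`φ ∈ C¹_c`; FMRT 2001, Ch. IV p. 197). [cite: FMRT2001, Ch. IV §1.2, p. 197] -/
theorem exists_abs_nsGeneratorPairing_grad_le (ν : ℝ) {f : Vec d} (hf : MemLp f 2 volume)
    (Φ : CylindricalTest d) :
    ∃ K : ℝ, 0 ≤ K ∧ ∀ u : FunctionSpaces.Torus.energySpace d,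
      |nsGeneratorPairing ν f u (Φ.grad u)| ≤ K * (1 + ‖u‖ ^ 2) := by
  obtain ⟨M, hM0, hM⟩ := Φ.exists_abs_fderiv_coords_le
  have hK : ∀ i : Fin Φ.m, ∃ K : ℝ, 0 ≤ K ∧ ∀ u : FunctionSpaces.Torus.energySpace d,
      |nsGeneratorPairing ν f u (Φ.g i)| ≤ K * (1 + ‖u‖ ^ 2) := fun i =>
    exists_abs_nsGeneratorPairing_le ν f (Φ.g_smooth i)
  choose K hK0 hK using hK
  refine ⟨∑ i, M * K i, Finset.sum_nonneg fun i _ => mul_nonneg hM0 (hK0 i), fun u => ?_⟩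
  rw [nsGeneratorPairing_grad ν (hf.integrable one_le_two) Φ u, Finset.sum_mul]
  refine (Finset.abs_sum_le_sum_abs _ _).trans (Finset.sum_le_sum fun i _ => ?_)
  rw [abs_mul, mul_assoc]
  exact mul_le_mul (hM u i) (hK i u) (abs_nonneg _) hM0

end Bounds

/-! ### Along a lifted `L²` slice the tested generator is the flux of the weak formulation -/

section Flux

/-- **Generator = flux.** If `U ∈ H` has the representative `w` (`U = w` a.e.), then for a smooth
field `g` and `f ∈ L²`
`⟨F(U), g⟩ = ∫ (⟪w, (w·∇)g⟫ + ν ⟪w, Δg⟫ + ⟪f, g⟫)`, the flux of the time-sliced weak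
formulation (`Torus.IsLerayHopfOn.integral_inner_eq_add_setIntegral`) — the link between the
Liouville integrand and `d/dt (u(t), g)` (FMRT 2001, App. B.2 (B.18)). [cite: FMRT2001, App. B.2 (B.18)] -/
theorem nsGeneratorPairing_eq_flux (ν : ℝ) {f : Vec d} (hf : MemLp f 2 volume) {g : Vec d}
    (hg : FunctionSpaces.Torus.IsSmooth g) {U : FunctionSpaces.Torus.energySpace d} {w : Vec d}
    (hw : ((U : L2T d) : Vec d) =ᵐ[volume] w) :
    nsGeneratorPairing ν f U g =
      ∫ x, (⟪w x, FunctionSpaces.Torus.convect w g x⟫ + ν * ⟪w x, FunctionSpaces.Torus.laplacian g x⟫ + ⟪f x, g x⟫) := by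
  have hU2 : MemLp ((U : L2T d) : Vec d) 2 volume := Lp.memLp _
  have hw2 : MemLp w 2 volume := hU2.ae_eq hw
  have hi1 : Integrable (fun x => ⟪w x, FunctionSpaces.Torus.convect w g x⟫) volume :=
    integrable_inner_convect_self hw2 hg
  have hi2 : Integrable (fun x => ν * ⟪w x, FunctionSpaces.Torus.laplacian g x⟫) volume :=
    (FunctionSpaces.Torus.integrable_inner_of_continuous (hw2.integrable one_le_two)
      hg.laplacian.continuous).const_mul ν
  have hi3 : Integrable (fun x => ⟪f x, g x⟫) volume :=
    FunctionSpaces.Torus.integrable_inner_of_continuous (hf.integrable one_le_two) hg.continuous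
  have hi12 : Integrable (fun x => ⟪w x, FunctionSpaces.Torus.convect w g x⟫ +
      ν * ⟪w x, FunctionSpaces.Torus.laplacian g x⟫) volume := hi1.add hi2
  rw [integral_add hi12 hi3, integral_add hi1 hi2, integral_const_mul]
  unfold nsGeneratorPairing inertialPairing
  have e2 : ∫ x, ⟪((U : L2T d) : Vec d) x, FunctionSpaces.Torus.laplacian g x⟫ =
      ∫ x, ⟪w x, FunctionSpaces.Torus.laplacian g x⟫ :=
    integral_congr_ae (hw.mono fun x hx => by simp only [hx])
  have e3 : ∫ x, ⟪FunctionSpaces.Torus.fderiv g x (((U : L2T d) : Vec d) x), ((U : L2T d) : Vec d) x⟫ =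
      ∫ x, ⟪w x, FunctionSpaces.Torus.convect w g x⟫ :=
    integral_congr_ae (hw.mono fun x hx => by
      simp only [hx, FunctionSpaces.Torus.convect]
      exact real_inner_comm _ _)
  rw [e2, e3]
  ring

end Flux

end Literature.Analysis.FluidPDE.Torus
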